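import Summits.AtomisticToContinuum.FouriersLaw.Theorems.BondHeatUncertaintyBoundedResponseBathHeatOctaveB
import HarnessLib

/-!
# BondHeatUncertainty / BoundedResponse — «Octave»: beneath (S) the blocker 11071 is a statement about ONE Thouless octave of ONE scalar curve
(decomp-a2c lens-1 «grading / quantitative ladder», g118, NODE 118, RESIDUAL MODE; imports only the tree: NODE 117 `…BathHeatDCBand`, NODE 116
`…BathHeatOwedHeatPrice` (+ `HarnessLib`))

TARGET `BoundedResponse` = stmt-11071 (⟺ `OhmicFloor`: `E_N ≤ C₁/N`, `ohmicFloor_iff_boundedResponse`).  FREE INPUT of record: (S) `SubdiffusiveBondHeat`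
(the open crux of the route, never touched here).  The lineage's scalar curves (NODE 107): the bath-heat variance `𝒲_N(t) = bathHeatVar` (`≥ 0`), the
bath tail functional `B_N(t) = bathTail = γ²∫ min(r,t)·K_N(r) dr` of the contact kinetic-energy autocorrelation `K_N = bathKinCorr`, tied by the exact
budget `t·γT²E_N = 𝒲_N(t)/2 − B_N(t)` (`mul_escapeDeficit_eq_half_bathHeatVar_sub_bathTail`) — the classical mean-square-displacement ⁄ velocity-
autocorrelation identity `⟨X²(t)⟩ = 2∫₀ᵗ(t − s)φ(s)ds` with `X ↦ Q_t` (heat taken by the bath), `φ ↦` the contact current covariance, `D ↦ γT²E_N`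
[corpus: book:balakrishnan2020 p.217, eqs. (15.1)–(15.3)]; the owed heat `𝒯_N(v) = owedHeat = ∫_v^∞ K_N = (T²/γ)(1 − E_N − θ_N(v))` (NODE 115), so that
`B_N(t₂) − B_N(t₁) = γ²∫_{t₁}^{t₂} 𝒯_N` (`bathTail_sub_eq`) and `½𝒲_N' = γT²E_N + γ²𝒯_N`: the running slope of the heat variance sits ABOVE its final
value exactly where the chain still owes heat.  RESIDUALS OF RECORD beneath (S): (BT₁) `BathTailFloor 1` (NODE 107, all lags), `LateTailFloor a 1 1`
(NODE 109, lags `≥ aN`, necessary mod (BTᶜ₁)), supplied by NODE 115's (OH_a)/(OB_{a,1}), priced by NODE 116, band-dual (BDF_θ)/(BNM_I) in NODE 117.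

## The mechanism (three free facts, §1) and the door (§3)

(1) OCTAVE IDENTITY `B^early_N(s) = 𝒲_N(s) − 𝒲_N(2s)/2` (`bathTailEarly_eq_bathHeatVar`): in the early piece `γ²∫ min(r,s)K_N` of NODE 109's split the
two response terms `s·γT²E_N` CANCEL — `B^early_N(s) = −Cov(Q_s, Q_{2s} − Q_s)`, the covariance of two successive heat increments.
(2) FREE SANDWICH `−𝒲_N(2s)/2 ≤ B^early_N(s) ≤ 𝒲_N(s)` (`bathTailEarly_mem_Icc`, variance positivity, `N ≥ 2`) — replacing NODE 109's thermodynamic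
sandwich `|B^early_N(s)| ≤ 2γT²·s`, which is `O(N)` only at `s ≍ N` and is why every residual since g109 had to charge all lags from the light cone `aN` on.
(3) (S) IS A WINDOW STATEMENT: its bond-energy bound holds for all `t ≤ cN²`, so the free comparison chain of NODES 105–107 gives the WINDOW bound (BHᵂ₁)
`𝒲_N(t) ≤ C·N ∀ t ≤ cN²` (`bathHeatWindow_one_of_subdiffusiveBondHeat`), not just the point bound (BHᴾ₁) at `t = cN²`.
(1)+(2) at `s = t`: the OCTAVE INEQUALITY `t·γT²E_N ≤ 𝒲_N(2t)/2 − (B_N(2t) − B_N(t))` (`mul_escapeDeficit_le_of_octave`); with (3) at `t = c₁N²`,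
`2c₁ ≤ c`: `E_N ≤ [C/2 + C']/(c₁γT²) · 1/N` as soon as ONE octave increment of `B_N` at the Thouless scale is `≥ −C'N`.  Everything below the octave —
the light cone `r ≲ N`, the echo train `N ≲ r ≪ N²` where `K_N` is large and sign-indefinite (BKER-110) — is paid for by (S).

## Route statements (§2; all `UNDECIDED · INSTRUMENTABLE`, none a theorem of the tree, none mentions `E_N`) and the ladder

* (OR_g) `OctaveReturnFloor g`: `∀ c > 0 ∃ C N₀ ∀ N ≥ N₀: B_N(2cN²) − B_N(cN²) ≥ −C·N^g`.  FREE for `g ≥ 2` (`octaveReturnFloor_of_two_le`, thermodynamics);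
  door at `g = 1`; monotone in `g`.  `⟺ (TL_{1/2,g})` `ThoulessLateFloor (1/2) g` (NODE 109's late piece from `s = t/2`: `B^late_N(t/2,t) = 2(B_N(t) − B_N(t/2))`).
* (OR♭_g) `LowOctaveReturnFloor g`: the same for `c ≤ c₀` only (`∃ c₀ > 0`).  ★★★ THE RESIDUAL: `(S) ∧ (OR♭₁) ⟹ 11071`
  (`boundedResponse_of_subdiffusiveBondHeat_lowOctaveReturnFloor`) AND `Ohm ∧ (BHᵂ₁) ⟹ (OR♭₁)` (`lowOctaveReturnFloor_of_boundedResponse_bathHeatWindow`):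
  ★★★ beneath (S), `11071 ⟺ (OR♭₁)` (`boundedResponse_iff_lowOctaveReturnFloor_of_subdiffusiveBondHeat`) — exact like (BT₁) (NODE 107) and (BDF_θ)
  (NODE 117), but charging only lags `≍ N²`; (OR₁) and (TL_{κ,1}) are necessary given Ohm modulo the ceiling (BTᶜ₁) (`∀ c`), which (S) does not give.
* (TNM) `ThoulessNegMass`: `(γ/T²)∫_{r > cN²} K_N⁻ ≤ C/N ∀ c > 0` — the kernel-level hub: `(TNM) ⟹ (OR₁)` (`octaveReturnFloor_of_thoulessNegMass`:
  `𝒯_N(v) ≥ −∫_{r>cN²}K_N⁻` on the octave); fed by NODE 109's (LNM_a) (`min(r,t)/t ≥ … ` not even needed: `∫_{r>cN²}K⁻ ≤ (aN)⁻¹∫ min(r,aN)K⁻`-free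
  comparison `thoulessNegMass_of_lateNegMass`), by NODE 117's (BNM_I) (band weight `w_I ≥ 1/4` on `[N²/2, N²] ⊇` nothing is needed below `cN²`:
  `thoulessNegMass_of_bandNegMass`), by (BK⁺) `BathKernelNonneg` (constant `0`).
* (TRS) `ThoulessReturnSign`: `∃ c₀ ∀ c ∃ N₀ ∀ N ≥ N₀: 𝒯_N ≥ 0 on [cN², c₀N²]` — the SIGNED, RATE-FREE rung: the running slope `½𝒲_N'` has not undershot
  its limit at the low Thouless lags (equivalently `B_N` is still increasing there; NODE 115's (OH_a) asks this from the light cone on,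
  `lateOwedHeatSign_iff_bathTail_monotoneOn`).  `(TRS) ⟹ (OR♭_g)` with constant `0` at EVERY grade (`lowOctaveReturnFloor_of_thoulessReturnSign`);
  `(OH_a) ⟹ (TRS)`; NODE 116's calibration floor `(DF_{a,α}) ⟹ (TRS)` for EVERY `α` (`thoulessReturnSign_of_lateReturnFloor`; bookkeeping for the
  price table only — (DF) is a pricing hypothesis, not a supplier: NOT-AGAIN).  ★★ `(S) ∧ (TRS) ⟹ 11071` (`boundedResponse_of_subdiffusiveBondHeat_thoulessReturnSign`).
* Placement (every arrow a theorem of this file or the tree; «⟸» = implied by):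
  `11071 ⟺[beneath (S)] (OR♭₁) ⟸ (OR₁) ⟸ (TNM) ⟸ {(LNM_a) N109, (BNM_I) N117, (BK⁺) N107}`;  `(OR₁) ⟸ (OB_{a,1}) N115 ⟸ {(OH_a), (T1_{a,1}), (T2⁸_a),
  (DC_{a,α≥1/2}) N116}`;  `(OR₁) ⟸ (RT∞) ⟸ (RT) g97`;  `(OR♭_g) ⟸ (TRS) ⟸ {(OH_a) N115, (DF_{a,α}) N116}`;  `(OR₁) ⟺ (TL_{1/2,1})`, `(TL_{κ,1})`
  (`0 < κ ≤ 1`) also closes the door (`boundedResponse_of_subdiffusiveBondHeat_thoulessLateFloor`).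

## Price (NODE 116 calibration (DC½) ∧ (DF½): `R_N(v) = (γ/T²)𝒯_N(v) ≍ A·v^{−1/2}`, `A ≈ 0.37` at P4, on `aN ≤ v ≤ c₀N²`)
Octave number `[B_N(2cN²) − B_N(cN²)]/N = γT²·N⁻¹∫_{cN²}^{2cN²} R_N → 2(√2 − 1)·γT²·A·√c > 0` for octaves inside the calibrated window (P4, `c = 1/4`:
`≈ +2.45`; `c = 1/8`: `≈ +1.73`), `→ 0⁺` beyond `c₀` (post-Thouless exponential return).  VERDICT: (OR₁)/(OR♭₁) are diffusively TRUE WITH ROOM — they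
are FLOORS asked of a quantity whose calibrated value is POSITIVE, so they are not exponent-critical (contrast NODE 116: (T1_{a,1}), (T2⁸_a) TRUE-CRITICAL,
(T2_{a,0}) false by a log); in the sign-or-rate law they are «signed-tolerant»: the sign of (OH)/(TRS) up to a NEGATIVE return of relative size `C/(cN)`
averaged over the octave.  What they still ask is GLOBAL IN TIME AT FIXED `N`: the octave `[cN², 2cN²]` lies beyond every `N`-free horizon, where at
present only spectral-gap/hypocoercive information lives — and that runs at the WRONG SCALE: the sharp gap of the pinned harmonic chain is `≍ N^{−3}`
(Becker–Menegaki), the weakly anharmonic entropy/Wasserstein rates are `e^{−ct/N³}` with `poly(N)` prefactors (Menegaki 2020; Lu 2026) [corpus: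
paper:arxiv-2607.13953 p.3–4], so mixing bounds say nothing at `t ≍ N²` (and spectral-gap routes to Thouless-scale statements are on the lineage's NOT-AGAIN list: gap `≍ N⁻³ ≪ N⁻²`).
IDEA-NEEDED (unchanged in kind, sharper in place): a one-sided control of the heat still owed by the chain at Thouless times — a late maximum principle /
positivity of the coarse-grained return (harmonic: Bochner, `K_N ≥ 0`), or an `L¹` bound `O(T²/(γN))` on `K_N⁻` beyond `cN²` ((TNM)).

## Census OCTAVE-118 (pre-registration; zero kit here; instrument = BKER-110's variance tables I6, estimator `B_N = 𝒲_N/2 − t·γT²E_N^eq`)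
(i) ALREADY ON THE DESK (BKER-110 I1/I6, P4 = (1,8,1,1,4), `γT² = 16`): the double-octave number `[B_N(N²) − B_N(N²/4)]/N = +0.4, +1.3, +0.7, +4.1` at
`N = 16, 32, 64, 128` (errors `≈ ±2` from `E_N·N ± 0.14`) — POSITIVE and bounded below uniformly in `N`, as (OR♭₁) asks; below the calibrated ceiling
`γT²A·(2(1 − 1/2)) ≈ 5.9` (the upper octave `[N²/2, N²]` is already post-Thouless at P4).  (ii) TO RUN when the variance estimator next runs: single octaves
`Δ_N(c) := [B_N(2cN²) − B_N(cN²)]/N`, `c ∈ {1/16, 1/8, 1/4, 1/2}`, `N ∈ {16, …, 256}`; prediction `Δ_N(c) ∈ [0, 0.83·γT²A√c]`, `N`-flat.  Decision rule: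
`min_c Δ_N(c)` bounded below uniformly in `N` is CONSISTENT with (OR♭₁) (and, given (S), with Ohm); `Δ_N(c) ≍ −N^δ` at some fixed small `c` REFUTES (OR_1)
at that `c` and, if it persists as `c ↓`, (OR♭₁) — hence, given (S) at that parameter point, Ohm itself (exactness).  (iii) (TRS) is read off OWED-115's
running tails: `sign 𝒯_N(v)` for `v ∈ [N²/16, N²/2]`.

TAGS.  (OR♭₁): UNDECIDED · EXACT beneath (S) · WEAKEST (implied by every floor of NODES 97–117) · phonon-TRUE · INSTRUMENTABLE · IDEA-NEEDED.  (OR₁), (TL_{κ,1}):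
UNDECIDED · necessary mod (BTᶜ₁) · INSTRUMENTABLE.  (TNM): UNDECIDED · kernel hub · phonon-TRUE (constant 0).  (TRS): UNDECIDED · SIGNED · RATE-FREE ·
phonon-TRUE · INSTRUMENTABLE.  (BHᵂ₁): PROVED beneath (S) (this file).  Honest limits: (a) (OR♭₁) is EQUIVALENT to the blocker beneath (S) — it relocates
the difficulty (to one octave of one curve), it does not shrink it; (b) the «(DF) ⟹ 11071» door uses only the SIGN of NODE 116's calibration floor on the
low Thouless lags, i.e. it is (TRS) in calibrated clothing — (DF) itself stays a pricing hypothesis, not a proposed target; (c) no sub-Ohmic grade, band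
exponent, horizon or threshold is introduced: the only parameters are the grade `g` (free at 2, needed at 1) and the Thouless fraction `c`.

(part 3 of 3 = MAIN; imports part B `…BathHeatOctaveB` ⟵ part A `…BathHeatOctaveA`; this file: §7 — NODE 115's (OB_{a,1}) and g97's (RT∞) feed
(OR₁); the signed rate-free rung (TRS) ⟸ (OH_a), ⟸ NODE 116's (DF_{a,α}) for every `α`, and ★★ `(S) ∧ (TRS) ⟹ 11071`, `(S) ∧ (DF_{a,α}) ⟹ 11071`;
corollaries for (RT), (T1_{a,1}), (T2⁸_a); (BK⁺) ⟹ (TNM).  No `sorry`, no new axioms.)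
-/

open MeasureTheory ProbabilityTheory Filter Topology Set Function
open scoped NNReal ENNReal
open Literature.MathematicalPhysics.KineticTheory.HeatConduction
open Literature.MathematicalPhysics.KineticTheory OscillatorChain
open Literature.Probability.Process
open Summit.AtomisticToContinuum.FouriersLaw.Theorems.SubdiffusiveBondHeat
open Summit.AtomisticToContinuum.FouriersLaw.Theorems.SubdiffusiveBondHeat.EscapeGrading
open Summit.AtomisticToContinuum.FouriersLaw.Theorems.BoundedResponse.TransientBand
open Summit.AtomisticToContinuum.FouriersLaw.Theorems.BoundedResponse.ParityFloor

namespace Summit.AtomisticToContinuum.FouriersLaw.Theorems.BoundedResponse.HeatSpreading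

open Summit.AtomisticToContinuum.FouriersLaw.Theorems.BoundedResponse.TransientContact
open Summit.AtomisticToContinuum.FouriersLaw.Theses.BondHeatUncertainty (BoundedResponse SubdiffusiveBondHeat)

section Chain

variable {ω₂ lam β γ : ℝ} {T : ℝ}

/-! ## §7 Suppliers II: NODE 115's (OB_{a,1}), g97's (RT∞), the signed rung (TRS) ⟸ (OH_a), (DF_{a,α}); corollaries; (BK⁺) -/

/-- ★ **`LateOvershootBudget a 1 ⟹ (OR₁)`** (`a ≥ 0`): `∫_{cN²}^{2cN²}𝒯_N ≥ −∫_{cN²}^{2cN²}𝒯_N⁻ ≥ −𝒪_N(aN, 2cN²)` once `aN ≤ cN²`; NODE 115's weakest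
supplier (at horizon `2c`) feeds this node's. [this cell] -/
theorem octaveReturnFloor_of_lateOvershootBudget {a : ℝ} (ha : 0 ≤ a) (h : LateOvershootBudget a 1) : OctaveReturnFloor 1 := by
  intro ω₂ lam β γ hω hl hβ hγ T hT c hc
  obtain ⟨C, N₀, hC⟩ := h ω₂ lam β γ hω hl hβ hγ T hT (2 * c) (by positivity)
  obtain ⟨N₁, hN₁⟩ := eventually_lateWindow (a := a) (q := 1) hc N₀
  refine ⟨C, N₁, fun N hN => ?_⟩
  obtain ⟨hNN₀, hN1, hw⟩ := hN₁ N hN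
  have ht0 : (0 : ℝ) ≤ c * (N : ℝ) ^ 2 := by positivity
  have hs : (0 : ℝ) ≤ a * N := by positivity
  have hst : a * (N : ℝ) ≤ c * (N : ℝ) ^ 2 := by linarith
  have ht2 : c * (N : ℝ) ^ 2 ≤ 2 * (c * (N : ℝ) ^ 2) := by linarith
  have h3 := hC N hNN₀
  rw [Real.rpow_one] at h3 ⊢
  rw [show (2 : ℝ) * c * (N : ℝ) ^ 2 = 2 * (c * (N : ℝ) ^ 2) by ring] at h3
  rw [bathTail_octave_eq_owedHeat hω hl hβ hγ hT N ht0]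
  obtain ⟨hI, hIm⟩ := intervalIntegrable_owedHeat hω hl hβ hγ hT N ht0 ht2
  obtain ⟨-, hIm'⟩ := intervalIntegrable_owedHeat hω hl hβ hγ hT N hs (hst.trans ht2)
  -- ∫_{t}^{2t} 𝒯 ≥ -∫_{t}^{2t} 𝒯⁻ ≥ -∫_{aN}^{2t} 𝒯⁻
  have h1 : ∫ v in (c * (N : ℝ) ^ 2)..(2 * (c * (N : ℝ) ^ 2)), -max (-(owedHeat ω₂ lam β γ T N v)) 0 ≤
      ∫ v in (c * (N : ℝ) ^ 2)..(2 * (c * (N : ℝ) ^ 2)), owedHeat ω₂ lam β γ T N v :=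
    intervalIntegral.integral_mono_on ht2 hIm.neg hI fun v _ => by
      have := le_max_left (-(owedHeat ω₂ lam β γ T N v)) 0
      linarith
  have h2 : ∫ v in (c * (N : ℝ) ^ 2)..(2 * (c * (N : ℝ) ^ 2)), max (-(owedHeat ω₂ lam β γ T N v)) 0 ≤
      lateOvershoot ω₂ lam β γ T N (a * N) (2 * (c * (N : ℝ) ^ 2)) :=
    intervalIntegral.integral_mono_interval hst ht2 le_rfl (ae_of_all _ fun v => le_max_right _ _) hIm'
  rw [intervalIntegral.integral_neg] at h1
  nlinarith [mul_le_mul_of_nonneg_left (h1.trans' (neg_le_neg h2)) (sq_nonneg γ), sq_nonneg γ]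

/-- ★ **`ReturnTailFloor ⟹ (OR₁)`** (g97 (RT∞) at `A = c`: `N·(γ/T²)𝒯_N(t) ≥ −C` on `[cN², 2cN²]`, so `B_N(2cN²) − B_N(cN²) ≥ −cγT²C·N`) — hence the NEW
g97-side door (S) ∧ (RT∞) ⟹ 11071 with no survival / cross / leak leg (`boundedResponse_of_subdiffusiveBondHeat_returnTailFloor`). [this cell] -/
theorem octaveReturnFloor_of_returnTailFloor (hR : ReturnTailFloor) : OctaveReturnFloor 1 := by
  intro ω₂ lam β γ hω hl hβ hγ T hT c hc
  obtain ⟨C, hev⟩ := hR ω₂ lam β γ hω hl hβ hγ T hT c hc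
  obtain ⟨N₁, hN₁⟩ := eventually_atTop.1 hev
  refine ⟨c * (γ * T ^ 2) * max C 0, max N₁ 1, fun N hN => ?_⟩
  have hNN₁ : N₁ ≤ N := le_trans (le_max_left _ _) hN
  have hN1 : 1 ≤ N := le_trans (le_max_right _ _) hN
  have hNpos : (0 : ℝ) < N := by exact_mod_cast (show 0 < N by omega)
  have ht0 : (0 : ℝ) ≤ c * (N : ℝ) ^ 2 := by positivity
  have hRN := hN₁ N hNN₁
  set L := max C 0 * T ^ 2 / (γ * N) with hLdef
  have hL : ∀ v ∈ Icc (c * (N : ℝ) ^ 2) (2 * (c * (N : ℝ) ^ 2)), -L ≤ owedHeat ω₂ lam β γ T N v := by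
    intro v hv
    have h1 := hRN v hv
    have e : (fun u => escapeKernel ω₂ lam β γ T N u) = fun u => bathKinCorr ω₂ lam β γ T N u := funext (escapeKernel_eq_bathKinCorr ω₂ lam β γ T N)
    simp only [e] at h1
    have h2 : (N : ℝ) * (γ / T ^ 2 * ∫ u in Ioi v, bathKinCorr ω₂ lam β γ T N u) = (N * γ * owedHeat ω₂ lam β γ T N v) / T ^ 2 := by
      unfold owedHeat; ring
    rw [h2, le_div_iff₀ (by positivity)] at h1
    rw [hLdef, neg_le, le_div_iff₀ (by positivity)]
    nlinarith [mul_le_mul_of_nonneg_right (le_max_left C 0) (sq_nonneg T)]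
  have h := bathTail_octave_ge_of_owedHeat_ge hω hl hβ hγ hT N ht0 hL
  rw [Real.rpow_one]
  have e : γ ^ 2 * (c * (N : ℝ) ^ 2 * L) = c * (γ * T ^ 2) * max C 0 * N := by
    rw [hLdef]
    field_simp
  linarith [e.symm.le, e.le]

/-- ★★ **NEW g97-SIDE DOOR: (S) ∧ (RT∞) ⟹ 11071** — the return-tail floor on the Thouless window alone closes the blocker beneath (S); g97 needed
(RT∞) ∧ (TW)/(WSP) (transmission / window-survival legs), NODE 109 needed a floor from the light cone on. [this cell] -/
theorem boundedResponse_of_subdiffusiveBondHeat_returnTailFloor (hS : SubdiffusiveBondHeat) (hR : ReturnTailFloor) : BoundedResponse :=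
  boundedResponse_of_subdiffusiveBondHeat_octaveReturnFloor hS (octaveReturnFloor_of_returnTailFloor hR)

/-- **`LateNegMass a ⟹ (OR₁)`** and **`BandNegMass ⟹ (OR₁)`** through (TNM). [formal bookkeeping] -/
theorem octaveReturnFloor_of_lateNegMass {a : ℝ} (ha : 0 ≤ a) (hM : LateNegMass a) : OctaveReturnFloor 1 :=
  octaveReturnFloor_of_thoulessNegMass (thoulessNegMass_of_lateNegMass ha hM)

/-- (BNM) ⟹ (OR₁), via the Thouless negative-mass hub. [ladder corollary; lane docstring, hand-2 g42] -/
theorem octaveReturnFloor_of_bandNegMass (hQ : BandNegMass) : OctaveReturnFloor 1 :=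
  octaveReturnFloor_of_thoulessNegMass (thoulessNegMass_of_bandNegMass hQ)

/-- ★ **(TRS) ⟹ (OR♭_g) with constant `0` at every grade** (`c₀ ↦ c₀/2`: the octave `[cN², 2cN²]`, `c ≤ c₀/2`, lies in `[cN², c₀N²]`). [this cell] -/
theorem lowOctaveReturnFloor_of_thoulessReturnSign (h : ThoulessReturnSign) (g : ℝ) : LowOctaveReturnFloor g := by
  intro ω₂ lam β γ hω hl hβ hγ T hT
  obtain ⟨c₀, hc₀, h'⟩ := h ω₂ lam β γ hω hl hβ hγ T hT
  refine ⟨c₀ / 2, by positivity, fun c hc hcc₀ => ?_⟩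
  obtain ⟨N₀, hN₀⟩ := h' c hc
  refine ⟨0, N₀, fun N hN => ?_⟩
  have hN2r : (0 : ℝ) ≤ (N : ℝ) ^ 2 := sq_nonneg _
  have ht0 : (0 : ℝ) ≤ c * (N : ℝ) ^ 2 := by positivity
  rw [zero_mul, neg_zero]
  have h1 := bathTail_octave_ge_of_owedHeat_ge hω hl hβ hγ hT N ht0 (L := 0) fun v hv => by
    rw [neg_zero]
    exact hN₀ N hN v hv.1 (by nlinarith [hv.2])
  simpa using h1

/-- **(OH_a) ⟹ (TRS)** (any `a`; NODE 115's signed piece asks the sign from the light cone on). [formal bookkeeping] -/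
theorem thoulessReturnSign_of_lateOwedHeatSign {a : ℝ} (h : LateOwedHeatSign a) : ThoulessReturnSign := by
  intro ω₂ lam β γ hω hl hβ hγ T hT
  obtain ⟨N₀, hN₀⟩ := h ω₂ lam β γ hω hl hβ hγ T hT
  refine ⟨1, one_pos, fun c hc => ?_⟩
  obtain ⟨N₁, hN₁⟩ := eventually_lateWindow (a := a) (q := 1) hc N₀
  refine ⟨N₁, fun N hN v hv1 _ => ?_⟩
  obtain ⟨hNN₀, -, hw⟩ := hN₁ N hN
  exact hN₀ N hNN₀ v (by linarith)

/-- ★ **(DF_{a,α}) ⟹ (TRS) for EVERY exponent `α` and every `a`**: NODE 116's diffusive calibration FLOOR `𝒯_N(v) ≥ a₀v^{−α} > 0` on `[aN, c₀N²]`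
carries the sign on the low Thouless lags; the rate is not used. [this cell] -/
theorem thoulessReturnSign_of_lateReturnFloor {a α : ℝ} (h : LateReturnFloor a α) : ThoulessReturnSign := by
  intro ω₂ lam β γ hω hl hβ hγ T hT
  obtain ⟨c₀, hc₀, a₀, ha₀, N₀, hN₀⟩ := h ω₂ lam β γ hω hl hβ hγ T hT
  refine ⟨c₀, hc₀, fun c hc => ?_⟩
  obtain ⟨N₁, hN₁⟩ := eventually_lateWindow (a := a) (q := 1) hc N₀
  refine ⟨N₁, fun N hN v hv1 hv2 => ?_⟩
  obtain ⟨hNN₀, hN1, hw⟩ := hN₁ N hN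
  have hNpos : (0 : ℝ) < N := by exact_mod_cast (show 0 < N by omega)
  have hvpos : 0 < v := lt_of_lt_of_le (by positivity) hv1
  exact le_trans (mul_nonneg ha₀.le (Real.rpow_nonneg hvpos.le _)) (hN₀ N hNN₀ v (by linarith) hv2)

/-- ★★ **BENEATH (S): (S) ∧ (TRS) ⟹ 11071** — no overshoot of the contact step response on the low Thouless lags closes the blocker. [this cell] -/
theorem boundedResponse_of_subdiffusiveBondHeat_thoulessReturnSign (hS : SubdiffusiveBondHeat) (h : ThoulessReturnSign) : BoundedResponse :=
  boundedResponse_of_subdiffusiveBondHeat_lowOctaveReturnFloor hS (lowOctaveReturnFloor_of_thoulessReturnSign h 1)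

/-- **Bookkeeping for NODE 116's price table: (S) ∧ (DF_{a,α}) ⟹ 11071 (any `a`, `α`)** — the calibration FLOOR alone closes the door, through its
SIGN on the low Thouless lags only (it is (TRS) in calibrated clothing).  (DF) stays what NODE 116 made it — a two-sided-rate PRICING HYPOTHESIS, harder
than the blocker and NOT a proposed supplier (NOT-AGAIN «DF as a positive supplier»); the line of attack is (TRS)/(OR♭₁). [formal bookkeeping] -/
theorem boundedResponse_of_subdiffusiveBondHeat_lateReturnFloor {a α : ℝ} (hS : SubdiffusiveBondHeat) (h : LateReturnFloor a α) :
    BoundedResponse :=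
  boundedResponse_of_subdiffusiveBondHeat_thoulessReturnSign hS (thoulessReturnSign_of_lateReturnFloor h)

/-- **The remaining late-window suppliers of NODES 97/115/116 feed (OR₁)**: (RT) `ReturnTailSign`, (OH_a) `LateOwedHeatSign`, (T1_{a,1})
`LateVariationBudget`, (T2⁸_a) `OctaveSquareBudget` (each through (RT∞) or (OB_{a,1})). [formal bookkeeping] -/
theorem octaveReturnFloor_of_returnTailSign (h : ReturnTailSign) : OctaveReturnFloor 1 :=
  octaveReturnFloor_of_returnTailFloor (returnTailFloor_of_returnTailSign h)

/-- A late owed-heat SIGN gives (OR₁), via the late overshoot budget. [ladder corollary; lane docstring, hand-2 g42] -/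
theorem octaveReturnFloor_of_lateOwedHeatSign {a : ℝ} (ha : 0 ≤ a) (h : LateOwedHeatSign a) : OctaveReturnFloor 1 :=
  octaveReturnFloor_of_lateOvershootBudget ha (lateOvershootBudget_of_lateOwedHeatSign h 1)

/-- The late variation budget at grade `1` gives (OR₁), via the late overshoot budget. [ladder corollary; lane docstring, hand-2 g42] -/
theorem octaveReturnFloor_of_lateVariationBudget {a : ℝ} (ha : 0 ≤ a) (h : LateVariationBudget a 1) : OctaveReturnFloor 1 :=
  octaveReturnFloor_of_lateOvershootBudget ha (lateOvershootBudget_of_lateVariationBudget ha h)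

/-- The octave square budget gives (OR₁), via the grade-`1` late variation budget. [ladder corollary; lane docstring, hand-2 g42] -/
theorem octaveReturnFloor_of_octaveSquareBudget {a : ℝ} (ha : 0 < a) (h : OctaveSquareBudget a) : OctaveReturnFloor 1 :=
  octaveReturnFloor_of_lateVariationBudget ha.le (lateVariationBudget_one_of_octaveSquareBudget ha h)

/-- **An eventually nonnegative kernel tail gives (TNM) with constant `0`** (`BathKernelNonneg`, NODE 107: `K_N ≥ 0` beyond a fixed lag `r₀`, which
`cN²` eventually exceeds). [formal bookkeeping] -/
theorem thoulessNegMass_of_bathKernelNonneg (hK : BathKernelNonneg) : ThoulessNegMass := by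
  intro ω₂ lam β γ hω hl hβ hγ T hT c hc
  obtain ⟨r₀, hr₀, N₀, hN₀⟩ := hK ω₂ lam β γ hω hl hβ hγ T hT
  obtain ⟨N₁, hN₁⟩ := eventually_lateWindow (a := r₀) (q := 1) hc N₀
  refine ⟨0, N₁, fun N hN => ?_⟩
  obtain ⟨hNN₀, hN1, hw⟩ := hN₁ N hN
  have hN1r : (1 : ℝ) ≤ N := by exact_mod_cast hN1
  have hr₀t : r₀ ≤ c * (N : ℝ) ^ 2 := by nlinarith
  have h0 : ∫ r in Ioi (c * (N : ℝ) ^ 2), max (-(bathKinCorr ω₂ lam β γ T N r)) 0 = 0 := by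
    refine setIntegral_eq_zero_of_forall_eq_zero fun r hr => ?_
    have := hN₀ N hNN₀ r (hr₀t.trans (le_of_lt hr))
    simp [this]
  rw [h0, mul_zero, zero_div]

end Chain

end Summit.AtomisticToContinuum.FouriersLaw.Theorems.BoundedResponse.HeatSpreading
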